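import Summits.BirchSwinnertonDyer.BirchSwinnertonDyer.Theorems.InertBadSignedBranchesInertBadAtThreeNonNullOddHeegner
import Literature.NumberTheory.EllipticCurves.HeegnerHypothesisKroneckerProofs
import HarnessLib

/-!
# C⁺ currency: the Heegner box has positive density; the class-number-only form of `stub_nonNullIndivisibleHeegner`

Crux `HeegnerTwistCouplingInSupply` (stmt-BirchSwinnertonDyer-21381, route `BiquadraticEisensteinDescent`),
line `size_tail` v4 (skeleton `91e83c171476`, lead `bsd-line-ibd-p1`), registered RESEARCH stub
`stub_nonNullIndivisibleHeegner : ∀ N p, N ≠ 0 → p.Prime → 5 ≤ p → ¬ twistDensity (fun d ↦ ∃ K imaginary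
quadratic, d_K = d ∧ 4 < |d| ∧ SatisfiesHeegnerHypothesis N K ∧ ¬ p ∣ h_K) 0` ("C⁺(N,p)"). This file does
NOT prove the stub (for `p ≥ 5` a positive proportion of `p`-indivisible class numbers in a family of
imaginary quadratic fields is not in print: Kohnen–Ono 1999 give `≫ √X / log X`, Wiles 2015 /
Beckwith–Raum–Richter 2024 existence with local conditions; expected: the Cohen–Lenstra proportion).
THEOREMS ONLY (no definition, no named fact): the stub is split into its UNCONDITIONAL half and its open
CLASS-NUMBER half, in the stub's own currency.

* §1 `satisfiesHeegnerHypothesis_of_discr_modEq_one` — any quadratic `K` with `d_K ≡ 1 (mod 8N)` satisfies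
  the Heegner hypothesis for `N` (decomposition law, `satisfiesHeegnerHypothesis_iff_kronecker`); `|d| > 4`.
* §2 `not_twistDensity_zero_of_tendsto_of_eventually_le` — counting engine: a predicate whose counting
  function eventually dominates `t(X)` with `t(X)/X → c₀ > 0` is not null (reference count `≤ 2X + 1`).
* §3 ★ `not_twistDensity_heegnerBox_zero` — the `p`-FREE Heegner box `{d : ∃ K imaginary quadratic,
  d_K = d, |d| > 4, Heegner for N}` is NOT `twistDensity`-null (`N ≠ 0`), UNCONDITIONALLY: it contains the
  squarefree `d < 0`, `d ≡ 1 (mod 8N)`, counted by the tree's `exists_pos_tendsto_card_progression_div`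
  (Prachar); explicit eventual lower bound `exists_pos_eventually_le_heegnerBox_ratio`.
* §4 ★★ `not_twistDensity_zero_of_relLowerDensity` — for ANY `p`: a positive eventual lower proportion of
  `{p ∤ h(ℚ(√d))}` inside the progression `d ≡ 1 (mod 8N)` gives C⁺(N,p), the stub's conclusion at `(N, p)`
  VERBATIM; `…_heegnerOddFamily` — the same inside the odd Heegner family indexed by `negFundDiscrs X`
  (the carrier of the Bhargava–Varma fact `bv_threeTorsion_mean_imaginary_heegnerOdd`, i.e. the shape of a
  class-number density theorem "with local conditions"); `nonNullIndivisibleHeegner_of_relLowerDensity` —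
  all `(N, p)` at once, concluding the registered stub signature by value.
* §5 `exists_pos_frequently_le_heegnerBox_of_not_twistDensity_zero` — conversely C⁺(N,p) forces
  `{p ∤ h}` to be FREQUENTLY a fixed positive proportion of the Heegner box. So C⁺(N,p) is the statement
  «`p ∤ h_K` has positive upper relative density in the Heegner box of level `N`» about class numbers of
  imaginary quadratic fields alone; at `p = 3` it is Davenport–Heilbronn / Bhargava–Varma (tree
  `…InertBadAtThreeNonNullOddHeegner`, p615210), at `p ≥ 5` open.

HONEST LIMITS: bookkeeping in the stub's currency; nothing here bears on Burungale–Tian, Smith, Monsky or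
modularity (the line's other stub); nothing is closed. BSD is not proved by any of this.
-/

set_option linter.dupNamespace false -- `Summit.BirchSwinnertonDyer.BirchSwinnertonDyer.Theorems.…` (summit = sub, D-0017)
set_option autoImplicit false

noncomputable section

open scoped Classical
open Finset Filter Topology
open Literature.NumberTheory.QuadraticFields Literature.NumberTheory.QuadraticFields.Quadratic
  Literature.NumberTheory.EllipticCurves
open Summit.BirchSwinnertonDyer.BirchSwinnertonDyer.Theorems.InertBadSignedBranchesInertBadAtThreeNonNullOddHeegner
  (mem_heegnerOddFamily_of_modEq_one card_progression_le_card_heegnerOddFamily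
    exists_pos_tendsto_card_progression_div natCard_squarefree_abs_le_le natCard_squarefree_abs_le_pos)

universe u

namespace Summit.BirchSwinnertonDyer.BirchSwinnertonDyer.Theorems.BiquadraticEisensteinDescentHeegnerTwistCouplingInSupplyHeegnerBoxDensity

/-! ### §1 The progression `d_K ≡ 1 (mod 8N)`: Heegner hypothesis and `|d_K| > 4`, for any field `K` -/

/-- **`d_K ≡ 1 (mod 8N)` ⟹ every prime factor of `N` splits in `K`** (any quadratic field `K`):
`d_K ≡ 1 (mod 8)` splits `2` and `d_K ≡ 1 (mod ℓ)` gives `(d_K/ℓ) = (1/ℓ) = 1` for an odd prime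
`ℓ ∣ N` (`satisfiesHeegnerHypothesis_iff_kronecker`). [folklore] -/
theorem satisfiesHeegnerHypothesis_of_discr_modEq_one {N : ℕ} {K : Type u} [Field K] [NumberField K]
    (h2 : Module.finrank ℚ K = 2)
    (hd : NumberField.discr K ≡ 1 [ZMOD ((8 * N : ℕ) : ℤ)]) :
    SatisfiesHeegnerHypothesis N K := by
  rw [satisfiesHeegnerHypothesis_iff_kronecker N K h2]
  intro p hp hpN
  have h8 : NumberField.discr K ≡ 1 [ZMOD 8] := hd.of_dvd ⟨(N : ℤ), by push_cast; ring⟩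
  have hpdvd : (p : ℤ) ∣ ((8 * N : ℕ) : ℤ) := by
    exact_mod_cast Dvd.intro_left 8 rfl |>.trans (mul_dvd_mul_left 8 hpN)
  have hDp : NumberField.discr K ≡ 1 [ZMOD p] := hd.of_dvd hpdvd
  refine ⟨fun _ => h8, fun _ => ?_⟩
  rw [jacobiSym.mod_left' hDp, jacobiSym.one_left]

/-- A negative `d ≡ 1 (mod 8N)` has `|d| > 4` (indeed `d ≤ −7`). [folklore] -/
theorem four_lt_natAbs_of_modEq_one {N : ℕ} {d : ℤ} (hd : d ≡ 1 [ZMOD ((8 * N : ℕ) : ℤ)])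
    (hd0 : d < 0) : 4 < d.natAbs := by
  have h8 : d ≡ 1 [ZMOD 8] := hd.of_dvd ⟨(N : ℤ), by push_cast; ring⟩
  have h8' : d % 8 = 1 := h8
  omega

/-- **The Heegner hypothesis depends on `K` only through `d_K`** (two imaginary quadratic fields with
the same discriminant satisfy it simultaneously), by `satisfiesHeegnerHypothesis_iff_kronecker`.
[folklore] -/
theorem satisfiesHeegnerHypothesis_of_discr_eq {N : ℕ} {K : Type u} [Field K] [NumberField K]
    {K' : Type u} [Field K'] [NumberField K'] (h2 : Module.finrank ℚ K = 2)
    (h2' : Module.finrank ℚ K' = 2) (hd : NumberField.discr K' = NumberField.discr K)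
    (hH : SatisfiesHeegnerHypothesis N K) : SatisfiesHeegnerHypothesis N K' := by
  rw [satisfiesHeegnerHypothesis_iff_kronecker N K' h2', hd]
  exact (satisfiesHeegnerHypothesis_iff_kronecker N K h2).mp hH

/-! ### §2 The counting engine of `twistDensity`-non-nullity -/

/-- **Quantitative engine.** If `t(X)/X → c₀ > 0` and eventually `t(X) ≤ #{d squarefree : |d| ≤ X, P d}`,
then eventually the `twistDensity` proportion of `P` is at least `c₀/4` (the reference count
`#{d squarefree : |d| ≤ X}` is `≤ 2X + 1`). [folklore] -/
theorem exists_pos_eventually_le_ratio_of_tendsto {P : ℤ → Prop} {t : ℕ → ℝ} {c₀ : ℝ} (hc₀ : 0 < c₀)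
    (ht : Tendsto (fun X : ℕ => t X / X) atTop (𝓝 c₀))
    (hle : ∀ᶠ X : ℕ in atTop, t X ≤ (Nat.card {d : ℤ | Squarefree d ∧ |d| ≤ (X : ℤ) ∧ P d} : ℝ)) :
    ∃ c : ℝ, 0 < c ∧ ∀ᶠ X : ℕ in atTop,
      c ≤ (Nat.card {d : ℤ | Squarefree d ∧ |d| ≤ (X : ℤ) ∧ P d} : ℝ) /
        Nat.card {d : ℤ | Squarefree d ∧ |d| ≤ (X : ℤ)} := by
  refine ⟨c₀ / 4, by positivity, ?_⟩
  -- the comparison function `t X / (2X + 1) → c₀ / 2`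
  have hcmp : Tendsto (fun X : ℕ => t X / (2 * X + 1)) atTop (𝓝 (c₀ / 2)) := by
    have h1 : Tendsto (fun X : ℕ => (1 : ℝ) / X) atTop (𝓝 0) :=
      tendsto_const_nhds.div_atTop tendsto_natCast_atTop_atTop
    have hden : Tendsto (fun X : ℕ => (2 : ℝ) + 1 / X) atTop (𝓝 (2 + 0)) :=
      tendsto_const_nhds.add h1
    have hq := ht.div hden (by norm_num)
    rw [add_zero] at hq
    refine hq.congr' ?_
    filter_upwards [eventually_gt_atTop 0] with X hX
    have hX0 : (X : ℝ) ≠ 0 := by positivity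
    simp only [Pi.div_apply]
    field_simp
  have hev1 : ∀ᶠ X : ℕ in atTop, c₀ / 4 < t X / (2 * X + 1) :=
    (tendsto_order.1 hcmp).1 _ (by linarith)
  filter_upwards [hev1, hle, eventually_ge_atTop 1] with X h1 h2 hX1
  have hX0 : (0 : ℝ) < 2 * X + 1 := by positivity
  have hDenle : (Nat.card {d : ℤ | Squarefree d ∧ |d| ≤ (X : ℤ)} : ℝ) ≤ 2 * X + 1 :=
    natCard_squarefree_abs_le_le X
  have hDenpos : (0 : ℝ) < Nat.card {d : ℤ | Squarefree d ∧ |d| ≤ (X : ℤ)} := by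
    exact_mod_cast natCard_squarefree_abs_le_pos hX1
  have hNum0 : (0 : ℝ) ≤ (Nat.card {d : ℤ | Squarefree d ∧ |d| ≤ (X : ℤ) ∧ P d} : ℝ) :=
    Nat.cast_nonneg _
  calc c₀ / 4 ≤ t X / (2 * X + 1) := h1.le
    _ ≤ (Nat.card {d : ℤ | Squarefree d ∧ |d| ≤ (X : ℤ) ∧ P d} : ℝ) / (2 * X + 1) := by gcongr
    _ ≤ _ := div_le_div_of_nonneg_left hNum0 hDenpos hDenle

/-- **Engine.** If `t(X)/X → c₀ > 0` and eventually `t(X) ≤ #{d squarefree : |d| ≤ X, P d}`, then the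
squarefree `d` with `P d` are not a `twistDensity`-null set. [folklore] -/
theorem not_twistDensity_zero_of_tendsto_of_eventually_le {P : ℤ → Prop} {t : ℕ → ℝ} {c₀ : ℝ}
    (hc₀ : 0 < c₀) (ht : Tendsto (fun X : ℕ => t X / X) atTop (𝓝 c₀))
    (hle : ∀ᶠ X : ℕ in atTop, t X ≤ (Nat.card {d : ℤ | Squarefree d ∧ |d| ≤ (X : ℤ) ∧ P d} : ℝ)) :
    ¬ twistDensity P 0 := by
  intro hT
  obtain ⟨c, hc, hev⟩ := exists_pos_eventually_le_ratio_of_tendsto hc₀ ht hle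
  have hev' : ∀ᶠ X : ℕ in atTop, (Nat.card {d : ℤ | Squarefree d ∧ |d| ≤ (X : ℤ) ∧ P d} : ℝ) /
      Nat.card {d : ℤ | Squarefree d ∧ |d| ≤ (X : ℤ)} < c :=
    (tendsto_order.1 hT).2 _ hc
  obtain ⟨X, h1, h2⟩ := (hev.and hev').exists
  exact absurd h2 (not_lt.mpr h1)

/-- A finite set of integers all of which are squarefree, of absolute value `≤ X` and satisfy `P` has at
most `#{d squarefree : |d| ≤ X, P d}` elements. [folklore] -/
theorem card_le_natCard_of_forall_mem {P : ℤ → Prop} {X : ℕ} (S : Finset ℤ)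
    (hS : ∀ d ∈ S, Squarefree d ∧ |d| ≤ (X : ℤ) ∧ P d) :
    S.card ≤ Nat.card {d : ℤ | Squarefree d ∧ |d| ≤ (X : ℤ) ∧ P d} := by
  have hsub : (↑S : Set ℤ) ⊆ {d : ℤ | Squarefree d ∧ |d| ≤ (X : ℤ) ∧ P d} := fun d hd => hS d hd
  have h := Nat.card_mono (finite_setOf_squarefree_abs_le X _) hsub
  rwa [Nat.card_coe_set_eq, Set.ncard_coe_finset] at h

/-! ### §3 The `p`-free Heegner box is not null -/

/-- The squarefree `-X < d < 0` with `d ≡ 1 (mod 8N)` lie in the Heegner box of level `N`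
`{d squarefree : |d| ≤ X, ∃ K imaginary quadratic, d_K = d, |d| > 4, Heegner for N}`. [folklore] -/
theorem card_progression_le_natCard_heegnerBox (N X : ℕ) :
    ((Ico (-(X : ℤ) + 1) 0).filter (fun x => x ≡ 1 [ZMOD ((8 * N : ℕ) : ℤ)] ∧ Squarefree x)).card ≤
      Nat.card {d : ℤ | Squarefree d ∧ |d| ≤ (X : ℤ) ∧
        ∃ (K : Type) (_ : Field K) (_ : NumberField K), IsImaginaryQuadratic K ∧
          NumberField.discr K = d ∧ 4 < d.natAbs ∧ SatisfiesHeegnerHypothesis N K} := by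
  refine card_le_natCard_of_forall_mem _ fun d hd => ?_
  rw [Finset.mem_filter, Finset.mem_Ico] at hd
  obtain ⟨⟨hd1, hd0⟩, hmod, hsq⟩ := hd
  obtain ⟨-, K, iF, iN, hK, hdisc, hH⟩ := mem_heegnerOddFamily_of_modEq_one hmod hsq hd0
  exact ⟨hsq, abs_le.mpr ⟨by omega, by omega⟩, K, iF, iN, hK, hdisc,
    four_lt_natAbs_of_modEq_one hmod hd0, hH⟩

/-- **The Heegner box has positive lower proportion**: for `N ≠ 0` there is `c > 0` with, eventually in
`X`, `c ≤ #{d squarefree : |d| ≤ X, d in the Heegner box of level N} / #{d squarefree : |d| ≤ X}`.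
[folklore] -/
theorem exists_pos_eventually_le_heegnerBox_ratio {N : ℕ} (hN : N ≠ 0) :
    ∃ c : ℝ, 0 < c ∧ ∀ᶠ X : ℕ in atTop,
      c ≤ (Nat.card {d : ℤ | Squarefree d ∧ |d| ≤ (X : ℤ) ∧
        ∃ (K : Type) (_ : Field K) (_ : NumberField K), IsImaginaryQuadratic K ∧
          NumberField.discr K = d ∧ 4 < d.natAbs ∧ SatisfiesHeegnerHypothesis N K} : ℝ) /
        Nat.card {d : ℤ | Squarefree d ∧ |d| ≤ (X : ℤ)} := by
  obtain ⟨c₀, hc₀, hT⟩ := exists_pos_tendsto_card_progression_div hN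
  exact exists_pos_eventually_le_ratio_of_tendsto hc₀ hT
    (Eventually.of_forall fun X => by exact_mod_cast card_progression_le_natCard_heegnerBox N X)

/-- ★ **The `p`-free Heegner box is NOT a `twistDensity`-null set** (`N ≠ 0`): the squarefree `d` that
are discriminants of imaginary quadratic `K` with `|d| > 4` and every prime factor of `N` split in `K`
have positive lower proportion among all squarefree integers. This is the registered stub
`stub_nonNullIndivisibleHeegner` with its class-number conjunct `¬ p ∣ h_K` DELETED — unconditional.
[folklore] -/
theorem not_twistDensity_heegnerBox_zero {N : ℕ} (hN : N ≠ 0) :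
    ¬ twistDensity (fun d : ℤ ↦ ∃ (K : Type) (_ : Field K) (_ : NumberField K),
        IsImaginaryQuadratic K ∧ NumberField.discr K = d ∧ 4 < d.natAbs ∧
        SatisfiesHeegnerHypothesis N K) 0 := by
  obtain ⟨c₀, hc₀, hT⟩ := exists_pos_tendsto_card_progression_div hN
  exact not_twistDensity_zero_of_tendsto_of_eventually_le hc₀ hT
    (Eventually.of_forall fun X => by exact_mod_cast card_progression_le_natCard_heegnerBox N X)

/-! ### §4 C⁺(N,p) from a positive relative lower density of `p ∤ h` -/

/-- The members `d` of the progression (`-X < d < 0`, `d ≡ 1 (mod 8N)`, squarefree) carrying an imaginary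
quadratic field of discriminant `d` with `p ∤ h` lie in the stub's counting set at `(N, p)`. [folklore] -/
theorem card_progression_filter_le_natCard_stubSet (N p X : ℕ) :
    (((Ico (-(X : ℤ) + 1) 0).filter (fun x => x ≡ 1 [ZMOD ((8 * N : ℕ) : ℤ)] ∧ Squarefree x)).filter
        (fun d => ∃ (K : Type) (_ : Field K) (_ : NumberField K), IsImaginaryQuadratic K ∧
          NumberField.discr K = d ∧ ¬ p ∣ NumberField.classNumber K)).card ≤
      Nat.card {d : ℤ | Squarefree d ∧ |d| ≤ (X : ℤ) ∧
        ∃ (K : Type) (_ : Field K) (_ : NumberField K), IsImaginaryQuadratic K ∧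
          NumberField.discr K = d ∧ 4 < d.natAbs ∧ SatisfiesHeegnerHypothesis N K ∧
          ¬ p ∣ NumberField.classNumber K} := by
  refine card_le_natCard_of_forall_mem _ fun d hd => ?_
  rw [Finset.mem_filter, Finset.mem_filter, Finset.mem_Ico] at hd
  obtain ⟨⟨⟨hd1, hd0⟩, hmod, hsq⟩, K, iF, iN, hK, hdisc, hcl⟩ := hd
  refine ⟨hsq, abs_le.mpr ⟨by omega, by omega⟩, K, iF, iN, hK, hdisc,
    four_lt_natAbs_of_modEq_one hmod hd0, ?_, hcl⟩
  exact satisfiesHeegnerHypothesis_of_discr_modEq_one hK.1 (hdisc ▸ hmod)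

/-- ★★ **C⁺(N,p) from a positive relative lower density in the progression** (`N ≠ 0`, any `p`): if for
some `c > 0`, eventually in `X`, at least the proportion `c` of the squarefree `-X < d < 0`,
`d ≡ 1 (mod 8N)` carry an imaginary quadratic field `ℚ(√d)` with `p ∤ h`, then the Heegner discriminants of
level `N` with `p ∤ h` are not `twistDensity`-null — the conclusion of `stub_nonNullIndivisibleHeegner` at
`(N, p)`, verbatim. (For `p ≥ 5` the hypothesis is the open Cohen–Lenstra-type input.) [folklore] -/
theorem not_twistDensity_zero_of_relLowerDensity {N : ℕ} (hN : N ≠ 0) (p : ℕ) {c : ℝ} (hc : 0 < c)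
    (hrel : ∀ᶠ X : ℕ in atTop,
      c * (((Ico (-(X : ℤ) + 1) 0).filter
          (fun x => x ≡ 1 [ZMOD ((8 * N : ℕ) : ℤ)] ∧ Squarefree x)).card : ℝ) ≤
        ((((Ico (-(X : ℤ) + 1) 0).filter
          (fun x => x ≡ 1 [ZMOD ((8 * N : ℕ) : ℤ)] ∧ Squarefree x)).filter
          (fun d => ∃ (K : Type) (_ : Field K) (_ : NumberField K), IsImaginaryQuadratic K ∧
            NumberField.discr K = d ∧ ¬ p ∣ NumberField.classNumber K)).card : ℝ)) :
    ¬ twistDensity (fun d : ℤ ↦ ∃ (K : Type) (_ : Field K) (_ : NumberField K),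
        IsImaginaryQuadratic K ∧ NumberField.discr K = d ∧ 4 < d.natAbs ∧
        SatisfiesHeegnerHypothesis N K ∧ ¬ p ∣ NumberField.classNumber K) 0 := by
  obtain ⟨c₀, hc₀, hT⟩ := exists_pos_tendsto_card_progression_div hN
  refine not_twistDensity_zero_of_tendsto_of_eventually_le (mul_pos hc hc₀)
    (t := fun X => c * (((Ico (-(X : ℤ) + 1) 0).filter
      (fun x => x ≡ 1 [ZMOD ((8 * N : ℕ) : ℤ)] ∧ Squarefree x)).card : ℝ)) ?_ ?_
  · simpa only [mul_div_assoc] using hT.const_mul c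
  · filter_upwards [hrel] with X hX
    exact hX.trans (by exact_mod_cast card_progression_filter_le_natCard_stubSet N p X)

/-- Inside the **odd Heegner family of level `N`** indexed by `negFundDiscrs X` (`D` odd, `D = d_K` with
every prime factor of `N` split in `K` — the carrier of the Bhargava–Varma mean
`bv_threeTorsion_mean_imaginary_heegnerOdd`): the members carrying a field with `p ∤ h`, except possibly
`D = -3`, lie in the stub's counting set. [folklore] -/
theorem card_heegnerOddFamily_filter_erase_le_natCard_stubSet (N p X : ℕ) :
    ((((negFundDiscrs X).filter (fun D => Odd D ∧ ∃ (K : Type) (_ : Field K) (_ : NumberField K),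
        IsImaginaryQuadratic K ∧ NumberField.discr K = D ∧ SatisfiesHeegnerHypothesis N K)).filter
        (fun D => ∃ (K : Type) (_ : Field K) (_ : NumberField K), IsImaginaryQuadratic K ∧
          NumberField.discr K = D ∧ ¬ p ∣ NumberField.classNumber K)).erase (-3)).card ≤
      Nat.card {d : ℤ | Squarefree d ∧ |d| ≤ (X : ℤ) ∧
        ∃ (K : Type) (_ : Field K) (_ : NumberField K), IsImaginaryQuadratic K ∧
          NumberField.discr K = d ∧ 4 < d.natAbs ∧ SatisfiesHeegnerHypothesis N K ∧
          ¬ p ∣ NumberField.classNumber K} := by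
  refine card_le_natCard_of_forall_mem _ fun D hD => ?_
  rw [Finset.mem_erase, Finset.mem_filter, Finset.mem_filter, mem_negFundDiscrs] at hD
  obtain ⟨hD3, ⟨⟨⟨hDX, hD0⟩, hfund⟩, hodd, K₁, iF₁, iN₁, hK₁, hdisc₁, hH₁⟩, K, iF, iN, hK, hdisc, hcl⟩ := hD
  have hsq4 : D % 4 = 1 ∧ Squarefree D := by
    rcases hfund with ⟨h4, hsq, -⟩ | ⟨h4dvd, -, -⟩
    · exact ⟨h4, hsq⟩
    · exfalso
      rw [Int.odd_iff] at hodd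
      omega
  refine ⟨hsq4.2, abs_le.mpr ⟨by omega, by omega⟩, K, iF, iN, hK, hdisc, by omega, ?_, hcl⟩
  exact satisfiesHeegnerHypothesis_of_discr_eq hK₁.1 hK.1 (hdisc.trans hdisc₁.symm) hH₁

/-- ★★ **C⁺(N,p) from a positive relative lower density in the odd Heegner family** (the Bhargava–Varma
carrier): if for some `c > 0`, eventually in `X`, at least the proportion `c` of the odd Heegner family of
level `N ≠ 0` in `negFundDiscrs X` carries an imaginary quadratic field with `p ∤ h`, then the stub's
conclusion holds at `(N, p)`. [folklore] -/
theorem not_twistDensity_zero_of_relLowerDensity_heegnerOddFamily {N : ℕ} (hN : N ≠ 0) (p : ℕ) {c : ℝ}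
    (hc : 0 < c)
    (hrel : ∀ᶠ X : ℕ in atTop,
      c * (((negFundDiscrs X).filter (fun D => Odd D ∧ ∃ (K : Type) (_ : Field K) (_ : NumberField K),
          IsImaginaryQuadratic K ∧ NumberField.discr K = D ∧ SatisfiesHeegnerHypothesis N K)).card : ℝ) ≤
        ((((negFundDiscrs X).filter (fun D => Odd D ∧ ∃ (K : Type) (_ : Field K) (_ : NumberField K),
          IsImaginaryQuadratic K ∧ NumberField.discr K = D ∧ SatisfiesHeegnerHypothesis N K)).filter
          (fun D => ∃ (K : Type) (_ : Field K) (_ : NumberField K), IsImaginaryQuadratic K ∧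
            NumberField.discr K = D ∧ ¬ p ∣ NumberField.classNumber K)).card : ℝ)) :
    ¬ twistDensity (fun d : ℤ ↦ ∃ (K : Type) (_ : Field K) (_ : NumberField K),
        IsImaginaryQuadratic K ∧ NumberField.discr K = d ∧ 4 < d.natAbs ∧
        SatisfiesHeegnerHypothesis N K ∧ ¬ p ∣ NumberField.classNumber K) 0 := by
  obtain ⟨c₀, hc₀, hT⟩ := exists_pos_tendsto_card_progression_div hN
  -- comparison function `c · #progression − 1`, with `(c · #progression − 1)/X → c c₀`
  refine not_twistDensity_zero_of_tendsto_of_eventually_le (mul_pos hc hc₀)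
    (t := fun X => c * (((Ico (-(X : ℤ) + 1) 0).filter
      (fun x => x ≡ 1 [ZMOD ((8 * N : ℕ) : ℤ)] ∧ Squarefree x)).card : ℝ) - 1) ?_ ?_
  · have h1 : Tendsto (fun X : ℕ => (1 : ℝ) / X) atTop (𝓝 0) :=
      tendsto_const_nhds.div_atTop tendsto_natCast_atTop_atTop
    have h := (hT.const_mul c).sub h1
    rw [sub_zero] at h
    refine h.congr' ?_
    filter_upwards [eventually_gt_atTop 0] with X hX
    have hX0 : (X : ℝ) ≠ 0 := by positivity
    field_simp
  · filter_upwards [hrel] with X hX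
    set TX : Finset ℤ := (Ico (-(X : ℤ) + 1) 0).filter
        (fun x => x ≡ 1 [ZMOD ((8 * N : ℕ) : ℤ)] ∧ Squarefree x) with hTX
    set QX : Finset ℤ := (negFundDiscrs X).filter (fun D => Odd D ∧
        ∃ (K : Type) (_ : Field K) (_ : NumberField K),
          IsImaginaryQuadratic K ∧ NumberField.discr K = D ∧ SatisfiesHeegnerHypothesis N K) with hQX
    set GX : Finset ℤ := QX.filter (fun D => ∃ (K : Type) (_ : Field K) (_ : NumberField K),
        IsImaginaryQuadratic K ∧ NumberField.discr K = D ∧ ¬ p ∣ NumberField.classNumber K) with hGX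
    set S : ℕ := Nat.card {d : ℤ | Squarefree d ∧ |d| ≤ (X : ℤ) ∧
        ∃ (K : Type) (_ : Field K) (_ : NumberField K), IsImaginaryQuadratic K ∧
          NumberField.discr K = d ∧ 4 < d.natAbs ∧ SatisfiesHeegnerHypothesis N K ∧
          ¬ p ∣ NumberField.classNumber K} with hS
    change c * (QX.card : ℝ) ≤ (GX.card : ℝ) at hX
    change c * (TX.card : ℝ) - 1 ≤ (S : ℝ)
    have hTQ : (TX.card : ℝ) ≤ (QX.card : ℝ) := by
      exact_mod_cast card_progression_le_card_heegnerOddFamily N X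
    have hG : (GX.erase (-3)).card ≤ S := card_heegnerOddFamily_filter_erase_le_natCard_stubSet N p X
    have hE : GX.card - 1 ≤ (GX.erase (-3)).card := Finset.pred_card_le_card_erase
    have h' : GX.card ≤ S + 1 := by omega
    have h'' : (GX.card : ℝ) ≤ (S : ℝ) + 1 := by exact_mod_cast h'
    linarith [mul_le_mul_of_nonneg_left hTQ hc.le]

/-- ★★ **The registered stub from the class-number density input, all levels and primes at once.**
If for every `N ≠ 0` and every prime `p ≥ 5` the `d` with `p ∤ h(ℚ(√d))` have positive eventual lower
proportion in the progression `{-X < d < 0 : d ≡ 1 (mod 8N), d squarefree}`, then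
`stub_nonNullIndivisibleHeegner` holds — its registered signature (line `size_tail` v4 of crux
`HeegnerTwistCouplingInSupply`) is the conclusion, by value. The hypothesis is NOT in print for any
`p ≥ 5` (Cohen–Lenstra-type); this theorem only fixes the currency. [folklore] -/
theorem nonNullIndivisibleHeegner_of_relLowerDensity
    (hrel : ∀ (N p : ℕ), N ≠ 0 → p.Prime → 5 ≤ p → ∃ c : ℝ, 0 < c ∧ ∀ᶠ X : ℕ in atTop,
      c * (((Ico (-(X : ℤ) + 1) 0).filter
          (fun x => x ≡ 1 [ZMOD ((8 * N : ℕ) : ℤ)] ∧ Squarefree x)).card : ℝ) ≤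
        ((((Ico (-(X : ℤ) + 1) 0).filter
          (fun x => x ≡ 1 [ZMOD ((8 * N : ℕ) : ℤ)] ∧ Squarefree x)).filter
          (fun d => ∃ (K : Type) (_ : Field K) (_ : NumberField K), IsImaginaryQuadratic K ∧
            NumberField.discr K = d ∧ ¬ p ∣ NumberField.classNumber K)).card : ℝ)) :
    ∀ (N p : ℕ), N ≠ 0 → p.Prime → 5 ≤ p → ¬ twistDensity (fun d : ℤ ↦ ∃ (K : Type) (_ : Field K)
      (_ : NumberField K), IsImaginaryQuadratic K ∧ NumberField.discr K = d ∧ 4 < d.natAbs ∧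
      SatisfiesHeegnerHypothesis N K ∧ ¬ p ∣ NumberField.classNumber K) 0 := by
  intro N p hN hp h5
  obtain ⟨c, hc, h⟩ := hrel N p hN hp h5
  exact not_twistDensity_zero_of_relLowerDensity hN p hc h

/-! ### §5 Conversely: C⁺(N,p) forces a positive upper relative density of `p ∤ h` in the box -/

/-- **Non-nullity gives a positive proportion frequently.** If the squarefree `d` with `P d` are not a
`twistDensity`-null set, then for some `c > 0`, frequently in `X`, they make up at least the proportion
`c` of all squarefree `|d| ≤ X` (the ratio is `≥ 0`, so not tending to `0` means exceeding a fixed `c > 0`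
infinitely often). [folklore] -/
theorem exists_pos_frequently_le_of_not_twistDensity_zero {P : ℤ → Prop} (h : ¬ twistDensity P 0) :
    ∃ c : ℝ, 0 < c ∧ ∃ᶠ X : ℕ in atTop,
      c * (Nat.card {d : ℤ | Squarefree d ∧ |d| ≤ (X : ℤ)} : ℝ) ≤
        (Nat.card {d : ℤ | Squarefree d ∧ |d| ≤ (X : ℤ) ∧ P d} : ℝ) := by
  by_contra hcon
  push Not at hcon
  apply h
  unfold twistDensity
  rw [Metric.tendsto_nhds]
  intro ε hε
  have hev := hcon (ε / 2) (by positivity)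
  filter_upwards [hev] with X hX
  rw [Real.dist_eq, sub_zero]
  have hNum0 : (0 : ℝ) ≤ (Nat.card {d : ℤ | Squarefree d ∧ |d| ≤ (X : ℤ) ∧ P d} : ℝ) :=
    Nat.cast_nonneg _
  have hDen0 : (0 : ℝ) ≤ (Nat.card {d : ℤ | Squarefree d ∧ |d| ≤ (X : ℤ)} : ℝ) := Nat.cast_nonneg _
  rcases hDen0.eq_or_lt with hD | hD
  · rw [← hD, div_zero, abs_zero]
    exact hε
  · rw [abs_of_nonneg (div_nonneg hNum0 hD.le), div_lt_iff₀ hD]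
    linarith

/-- The stub's counting set at `(N, p)` and the `p`-free Heegner box both lie inside the reference set of
all squarefree `|d| ≤ X`; in particular the box count is at most the reference count. [folklore] -/
theorem natCard_heegnerBox_le_natCard (N X : ℕ) :
    Nat.card {d : ℤ | Squarefree d ∧ |d| ≤ (X : ℤ) ∧
        ∃ (K : Type) (_ : Field K) (_ : NumberField K), IsImaginaryQuadratic K ∧
          NumberField.discr K = d ∧ 4 < d.natAbs ∧ SatisfiesHeegnerHypothesis N K} ≤
      Nat.card {d : ℤ | Squarefree d ∧ |d| ≤ (X : ℤ)} :=
  Nat.card_mono (finite_setOf_squarefree_abs_le' X) fun _ hd => ⟨hd.1, hd.2.1⟩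

/-- ★ **C⁺(N,p) ⟹ positive upper relative density of `p ∤ h` inside the Heegner box**: if the stub's
conclusion holds at `(N, p)`, then for some `c > 0`, frequently in `X`, at least the proportion `c` of the
Heegner box `{d squarefree : |d| ≤ X, ∃ K imaginary quadratic, d_K = d, |d| > 4, Heegner for N}` carries a
field with `p ∤ h`. With §3–§4: C⁺(N,p) is a statement about class numbers of imaginary quadratic fields
alone — for `p ≥ 5` not in print. [folklore] -/
theorem exists_pos_frequently_le_heegnerBox_of_not_twistDensity_zero {N p : ℕ}
    (h : ¬ twistDensity (fun d : ℤ ↦ ∃ (K : Type) (_ : Field K) (_ : NumberField K),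
        IsImaginaryQuadratic K ∧ NumberField.discr K = d ∧ 4 < d.natAbs ∧
        SatisfiesHeegnerHypothesis N K ∧ ¬ p ∣ NumberField.classNumber K) 0) :
    ∃ c : ℝ, 0 < c ∧ ∃ᶠ X : ℕ in atTop,
      c * (Nat.card {d : ℤ | Squarefree d ∧ |d| ≤ (X : ℤ) ∧
        ∃ (K : Type) (_ : Field K) (_ : NumberField K), IsImaginaryQuadratic K ∧
          NumberField.discr K = d ∧ 4 < d.natAbs ∧ SatisfiesHeegnerHypothesis N K} : ℝ) ≤
        (Nat.card {d : ℤ | Squarefree d ∧ |d| ≤ (X : ℤ) ∧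
          ∃ (K : Type) (_ : Field K) (_ : NumberField K), IsImaginaryQuadratic K ∧
            NumberField.discr K = d ∧ 4 < d.natAbs ∧ SatisfiesHeegnerHypothesis N K ∧
            ¬ p ∣ NumberField.classNumber K} : ℝ) := by
  obtain ⟨c, hc, hfr⟩ := exists_pos_frequently_le_of_not_twistDensity_zero h
  refine ⟨c, hc, hfr.mono fun X hX => le_trans ?_ hX⟩
  gcongr
  exact_mod_cast natCard_heegnerBox_le_natCard N X

end Summit.BirchSwinnertonDyer.BirchSwinnertonDyer.Theorems.BiquadraticEisensteinDescentHeegnerTwistCouplingInSupplyHeegnerBoxDensity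

end
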